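import Literature.AlgebraicGeometry.Resolution.BlowupChartModule
import Literature.AlgebraicGeometry.Resolution.BlowupAlgebraDerivations
import Literature.AlgebraicGeometry.Resolution.BlowupChartTransition
import Literature.AlgebraicGeometry.Resolution.RegularLocalRingsQuotient
import HarnessLib

/-!
# [OURS · L1 W4.5(b)] AVOID-L1: an equimultiple hypersurface misses the bad point of the blow-up of a non-regular lci curve

Crux chain w45b, working crux EL♮ = `Theses.EquisingularLift.EquisingularLiftNat` (stmt-ResolutionOfSingularities-20038), research
stub `stub_elnat_three`, helper AVOID-L1 of CRUX-PLAN v1.1 §3.4 L1 / v3 §4 (res-L1-w45b-plan-1) — «equimultiplicity ⇒ the strict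
transform misses the node's bad point», dealt to this seat by DE-COLLIDE v2 (2026-08-27T04:53:58Z). OURS; NOT a statement of any
manuscript; AI-written, weaker than expert review. `--supports stmt-ResolutionOfSingularities-20038 --as helper`.

DOWNSTAIRS SETTING (CRUX-PLAN v3 §1.1): the special fibre of a regular horizontal centre of EL♮ is a local complete intersection
`Z = V(e, w)` in the regular local ring `R = 𝒪_{P_k,q}` with `e` a regular parameter (`e ∈ 𝔪 ∖ 𝔪²`) and `w ∈ 𝔪²` not divisible by
`e` — a Δ-centre (`w = g`, a singular plane curve germ) or a comb (`w = xy`, a node). The `e`-chart of `Bl_Z Spec R` is the affine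
blowup algebra `B = R[Z/e] ⊆ R[1/e]` (`Literature…blowupAlgebra`), generated by `t = w/e`; its BAD POINT (the conifold vertex, the
unique non-regular point over `q`) is `𝔓₀ = 𝔪B + tB`. A hypersurface `H = V(y)` with `y ∈ (e, w)^ν` (multiplicity `≥ ν` along `Z`) and
`y ∉ 𝔪^{ν+1}` (multiplicity `≤ ν` at `q`) — i.e. EQUIMULTIPLE along `Z` at `q` — has strict transform `y/e^ν`, and:

* `exists_eq_mul_pow_add_mul_of_mem_span_pair_pow` — `y ∈ (e, w)^ν ⇒ y = c e^ν + w r` with `r ∈ (e, w)^{ν-1}`;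
* `aeval_gen_surjective` — `B = R[t]` (every element is a polynomial in `t = w/e`);
* `coeff_zero_mem_maximalIdeal_of_aeval_gen_eq_zero` — a polynomial relation `p(t) = 0` has constant term in `𝔪`
  (clearing denominators: `w ∣ p₀ e^{deg p}`, and `w ∣ e^d` would make `w` a power of the prime `e` up to a unit);
* `badPoint_ne_top`, `badPoint_isMaximal` — `𝔓₀ = 𝔪B + tB` is a maximal ideal of `B` with residue field `R/𝔪`
  (the evaluation `B = R[t] → R/𝔪`, `t ↦ 0`, is well defined and surjective with kernel `𝔓₀`);
* **`divPow_notMem_badPoint`** (AVOID-L1) — `y/e^ν ∉ 𝔓₀`: the strict transform of `H` AVOIDS the bad point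
  (`y ≡ c e^ν (mod w·(e,w)^{ν-1} ⊆ 𝔪^{ν+1})` forces `c` to be a unit, and `y/e^ν = c + t · (r/e^{ν-1})`);
* `divPow_notMem_of_le` — hence `y/e^ν ∉ Q` for every proper ideal `Q ⊇ 𝔓₀`-generators (points of the chart over `q` with `t = 0`).

Pure commutative algebra in the style of the line's toolkit (p456250 `stub_regularLift_of_not_dvd`, D1 `deltaFlat`).
References: res-L1-w45b-plan-1, CRUX-PLAN v1.1 §3.4 L1/L2, v3 §1.7/§4 (OURS planning texts); J. Kollár, *Lectures on Resolution
of Singularities* (2007), §3.9 (strict transforms in blow-up charts) — context only.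
-/

noncomputable section

set_option linter.dupNamespace false -- mandated namespace `Summit.<Summit>.<Problem>` of this single-conjunct summit

open IsLocalRing IsLocalization Polynomial
open Literature.AlgebraicGeometry.Resolution

namespace Summit.ResolutionOfSingularities.ResolutionOfSingularities.Cruxes.EquisingularLiftNat.Sections

universe u

/-! ## Decomposition of `(e, w)^ν` -/

/-- `y ∈ (e, w)^ν ⇒ y = c·e^ν + w·r` with `r ∈ (e, w)^{ν-1}` (any commutative ring). [folklore] -/
theorem exists_eq_mul_pow_add_mul_of_mem_span_pair_pow {R : Type u} [CommRing R] (e w : R) :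
    ∀ (ν : ℕ) {y : R}, y ∈ Ideal.span {e, w} ^ ν →
      ∃ c r : R, r ∈ Ideal.span {e, w} ^ (ν - 1) ∧ y = c * e ^ ν + w * r := by
  intro ν
  induction ν with
  | zero =>
    intro y _
    exact ⟨y, 0, Ideal.zero_mem _, by ring⟩
  | succ ν ih =>
    intro y hy
    rw [pow_succ] at hy
    refine Submodule.mul_induction_on hy ?_ ?_
    · intro a ha i hi
      obtain ⟨c, r, hr, rfl⟩ := ih ha
      obtain ⟨α, β, rfl⟩ := Ideal.mem_span_pair.mp hi
      refine ⟨c * α, c * β * e ^ ν + r * (α * e + β * w), ?_, by ring⟩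
      rw [Nat.add_sub_cancel]
      refine Ideal.add_mem _ (Ideal.mul_mem_left _ _ (Ideal.pow_mem_pow (Ideal.subset_span (by simp)) ν)) ?_
      rcases ν with _ | ν
      · simp
      · rw [Nat.add_sub_cancel] at hr
        rw [pow_succ]
        exact Ideal.mul_mem_mul hr hi
    · rintro x z ⟨c₁, r₁, hr₁, rfl⟩ ⟨c₂, r₂, hr₂, rfl⟩
      exact ⟨c₁ + c₂, r₁ + r₂, Ideal.add_mem _ hr₁ hr₂, by ring⟩

/-! ## The `e`-chart `B = R[(e,w)/e] = R[w/e]` and its bad point `𝔪B + (w/e)` -/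

section Chart

variable {R : Type u} [CommRing R] (e w : R)

/-- `w ∈ (e, w)`. [folklore] -/
theorem mem_span_pair_right : w ∈ Ideal.span ({e, w} : Set R) :=
  Ideal.subset_span (by simp)

/-- In `R[1/e]`, the affine blowup algebra of `(e, w)` at `e` is generated by the single element `w/e`. [folklore] -/
theorem blowupAlgebra_span_pair_eq_adjoin :
    blowupAlgebra (Ideal.span {e, w}) e =
      Algebra.adjoin R {algebraMap R (Localization.Away e) w * Away.invSelf e} := by
  rw [blowupAlgebra_eq_adjoin_of_span_eq (Ideal.span {e, w}) e (S := {e, w}) rfl, Set.image_pair,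
    Away.mul_invSelf, Algebra.adjoin_insert_one]

/-- **`B = R[t]`, `t = w/e`**: every element of `R[(e,w)/e]` is a polynomial in the generator `w/e`. [folklore] -/
theorem aeval_gen_surjective :
    Function.Surjective
      (Polynomial.aeval (R := R) (blowupAlgebra.gen (Ideal.span {e, w}) e w (mem_span_pair_right e w))) := by
  intro z
  have hz : (z : Localization.Away e) ∈
      Algebra.adjoin R {algebraMap R (Localization.Away e) w * Away.invSelf e} := by
    rw [← blowupAlgebra_span_pair_eq_adjoin]; exact z.2
  rw [Algebra.adjoin_singleton_eq_range_aeval] at hz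
  obtain ⟨p, hp⟩ := hz
  refine ⟨p, Subtype.ext ?_⟩
  rw [← hp]
  exact (Polynomial.aeval_algHom_apply (blowupAlgebra (Ideal.span {e, w}) e).val _ p).symm

variable {e w}

/-- If `e` is prime, `w ∉ (e)` and `w` is not a unit, then `w` divides no power of `e` (in a domain). [folklore] -/
theorem not_dvd_pow_of_prime_of_notMem [IsDomain R] (hprime : Prime e) (hwe : w ∉ Ideal.span {e})
    (hw : ¬ IsUnit w) (d : ℕ) : ¬ w ∣ e ^ d := by
  intro h
  obtain ⟨i, -, hi⟩ := (dvd_prime_pow hprime d).mp h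
  rcases i with _ | i
  · rw [pow_zero, associated_one_iff_isUnit] at hi
    exact hw hi
  · apply hwe
    rw [Ideal.mem_span_singleton]
    exact (dvd_pow_self e (Nat.succ_ne_zero i)).trans hi.symm.dvd

/-- **A polynomial relation `p(w/e) = 0` in `R[(e,w)/e]` has constant term in `𝔪`** (local `R`, domain, `e` prime, `w ∈ 𝔪 ∖ (e)`):
clearing denominators, `(scaleRoots p e)(w) = 0`, so `w ∣ p₀ · e^{deg p}`; a unit `p₀` would give `w ∣ e^{deg p}`. [folklore] -/
theorem coeff_zero_mem_maximalIdeal_of_aeval_gen_eq_zero [IsLocalRing R] [IsDomain R] (hprime : Prime e)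
    (hw : w ∈ maximalIdeal R) (hwe : w ∉ Ideal.span {e}) {p : R[X]}
    (hp : Polynomial.aeval (blowupAlgebra.gen (Ideal.span {e, w}) e w (mem_span_pair_right e w)) p = 0) :
    p.coeff 0 ∈ maximalIdeal R := by
  set B := blowupAlgebra (Ideal.span {e, w}) e
  set t := blowupAlgebra.gen (Ideal.span {e, w}) e w (mem_span_pair_right e w)
  -- clear denominators: `(scaleRoots p e)(w) = 0` in `B`, hence in `R`
  have h1 := Polynomial.scaleRoots_aeval_eq_zero (r := e) hp
  rw [blowupAlgebra.algebraMap_mul_gen, Polynomial.aeval_algebraMap_apply, Polynomial.coe_aeval_eq_eval] at h1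
  have hinjL : Function.Injective (algebraMap R (Localization.Away e)) :=
    IsLocalization.injective _ (powers_le_nonZeroDivisors_of_noZeroDivisors hprime.ne_zero)
  have hinj : Function.Injective (algebraMap R B) := by
    intro a b hab
    apply hinjL
    have := congrArg (Subtype.val : B → Localization.Away e) hab
    simpa [B, Subalgebra.coe_algebraMap] using this
  have h2 : (p.scaleRoots e).eval w = 0 := hinj (by rw [h1, map_zero])
  -- `w ∣ (scaleRoots p e)₀ = p₀ e^{deg p}`
  have h3 : w ∣ p.coeff 0 * e ^ p.natDegree := by
    obtain ⟨g, hg⟩ := Polynomial.X_dvd_sub_C (p := p.scaleRoots e)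
    have h := congrArg (Polynomial.eval w) hg
    rw [Polynomial.eval_sub, Polynomial.eval_C, h2, zero_sub, Polynomial.eval_mul, Polynomial.eval_X,
      Polynomial.coeff_scaleRoots, Nat.sub_zero] at h
    exact ⟨-g.eval w, by linear_combination -h⟩
  -- a unit constant term would make `w` divide a power of the prime `e`
  by_contra hp0
  have hu : IsUnit (p.coeff 0) := by
    by_contra h; exact hp0 ((mem_maximalIdeal _).mpr h)
  have hwu : ¬ IsUnit w := fun h => (mem_maximalIdeal _).mp hw h
  exact not_dvd_pow_of_prime_of_notMem hprime hwe hwu p.natDegree ((hu.dvd_mul_left).mp h3)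

/-- **The bad point is a point**: `𝔪B + (w/e)B ≠ ⊤` in `B = R[(e,w)/e]` (local domain `R`, `e` prime, `w ∈ 𝔪 ∖ (e)`) — the evaluation
`B = R[t] → R/𝔪`, `t ↦ 0`, is a well-defined ring map killing it. [folklore] -/
theorem badPoint_ne_top [IsLocalRing R] [IsDomain R] (hprime : Prime e) (hw : w ∈ maximalIdeal R)
    (hwe : w ∉ Ideal.span {e}) :
    (maximalIdeal R).map (algebraMap R (blowupAlgebra (Ideal.span {e, w}) e)) ⊔
        Ideal.span {blowupAlgebra.gen (Ideal.span {e, w}) e w (mem_span_pair_right e w)} ≠ ⊤ := by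
  set B := blowupAlgebra (Ideal.span {e, w}) e
  set t := blowupAlgebra.gen (Ideal.span {e, w}) e w (mem_span_pair_right e w)
  -- the evaluation `R[X] → R/𝔪`, `X ↦ 0`, factors through `aeval t : R[X] ↠ B`
  have hsurj := aeval_gen_surjective e w
  obtain ⟨χ, hχ⟩ : ∃ χ : B →+* ResidueField R, ∀ p : R[X], χ (Polynomial.aeval t p) = residue R (p.eval 0) := by
    -- generic: a surjection `f : R[X] ↠ B` whose kernel has constant terms in `𝔪` admits the evaluation `B → R/𝔪`
    suffices H : ∀ f : R[X] →+* B, Function.Surjective f → (∀ p : R[X], f p = 0 → p.coeff 0 ∈ maximalIdeal R) →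
        ∃ χ : B →+* ResidueField R, ∀ p : R[X], χ (f p) = residue R (p.eval 0) from
      H (Polynomial.aeval t).toRingHom (fun z => hsurj z)
        (fun p hp => coeff_zero_mem_maximalIdeal_of_aeval_gen_eq_zero hprime hw hwe hp)
    intro f hf hf0
    have hker : RingHom.ker f ≤ RingHom.ker ((residue R).comp (Polynomial.evalRingHom 0)) := by
      intro p hp
      rw [RingHom.mem_ker] at hp ⊢
      rw [RingHom.comp_apply, Polynomial.coe_evalRingHom, residue_eq_zero_iff, ← Polynomial.coeff_zero_eq_eval_zero]
      exact hf0 p hp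
    refine ⟨f.liftOfRightInverse (Function.surjInv hf) (Function.rightInverse_surjInv hf)
      ⟨(residue R).comp (Polynomial.evalRingHom 0), hker⟩, fun p => ?_⟩
    rw [RingHom.liftOfRightInverse_comp_apply, RingHom.comp_apply, Polynomial.coe_evalRingHom]
  have hχC : ∀ r : R, χ (algebraMap R B r) = residue R r := by
    intro r
    have h := hχ (C r)
    rwa [Polynomial.aeval_C, Polynomial.eval_C] at h
  have hχt : χ t = 0 := by
    have h := hχ X
    rwa [Polynomial.aeval_X, Polynomial.eval_X, map_zero] at h
  -- the bad-point ideal lies in the kernel of `χ`, a proper ideal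
  have hle : (maximalIdeal R).map (algebraMap R B) ⊔ Ideal.span {t} ≤ RingHom.ker χ := by
    refine sup_le ?_ ?_
    · rw [Ideal.map_le_iff_le_comap]
      intro m hm
      rw [Ideal.mem_comap, RingHom.mem_ker, hχC, residue_eq_zero_iff]
      exact hm
    · rw [Ideal.span_le, Set.singleton_subset_iff]
      exact hχt
  intro htop
  rw [htop, top_le_iff] at hle
  exact RingHom.ker_ne_top χ hle

/-- **The bad point is a closed point**: `𝔪B + (w/e)B` is a MAXIMAL ideal of `B = R[(e,w)/e]`, with residue field `R/𝔪` — modulo it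
every polynomial in `t = w/e` is congruent to its constant term. [folklore] -/
theorem badPoint_isMaximal [IsLocalRing R] [IsDomain R] (hprime : Prime e) (hw : w ∈ maximalIdeal R)
    (hwe : w ∉ Ideal.span {e}) :
    ((maximalIdeal R).map (algebraMap R (blowupAlgebra (Ideal.span {e, w}) e)) ⊔
        Ideal.span {blowupAlgebra.gen (Ideal.span {e, w}) e w (mem_span_pair_right e w)}).IsMaximal := by
  set B := blowupAlgebra (Ideal.span {e, w}) e
  set t := blowupAlgebra.gen (Ideal.span {e, w}) e w (mem_span_pair_right e w)
  set J := (maximalIdeal R).map (algebraMap R B) ⊔ Ideal.span {t}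
  rw [Ideal.isMaximal_iff]
  refine ⟨fun h1 => badPoint_ne_top hprime hw hwe ((Ideal.eq_top_iff_one _).mpr h1), ?_⟩
  intro K z hJK hzJ hzK
  -- `z = p(t) ≡ p₀ (mod t)`; `z ∉ J` forces `p₀ ∉ 𝔪`, a unit
  obtain ⟨p, rfl⟩ := aeval_gen_surjective e w z
  obtain ⟨g, hg⟩ := Polynomial.X_dvd_sub_C (p := p)
  have hdecomp : Polynomial.aeval t p = algebraMap R B (p.coeff 0) + t * Polynomial.aeval t g := by
    have h := congrArg (Polynomial.aeval t) hg
    rw [map_sub, Polynomial.aeval_C, map_mul, Polynomial.aeval_X] at h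
    linear_combination h
  have htK : t * Polynomial.aeval t g ∈ K := hJK (Ideal.mem_sup_right (Ideal.mul_mem_right _ _ (Ideal.mem_span_singleton_self t)))
  have hp0 : p.coeff 0 ∉ maximalIdeal R := by
    intro h0
    apply hzJ
    rw [hdecomp]
    exact Ideal.add_mem _ (Ideal.mem_sup_left (Ideal.mem_map_of_mem _ h0))
      (Ideal.mem_sup_right (Ideal.mul_mem_right _ _ (Ideal.mem_span_singleton_self t)))
  have hu : IsUnit (algebraMap R B (p.coeff 0)) := by
    have : IsUnit (p.coeff 0) := by by_contra h; exact hp0 ((mem_maximalIdeal _).mpr h)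
    exact this.map _
  have hcK : algebraMap R B (p.coeff 0) ∈ K := by
    have h := K.sub_mem hzK htK
    rwa [hdecomp, add_sub_cancel_right] at h
  exact K.eq_top_iff_one.mp (K.eq_top_of_isUnit_mem hcK hu)

end Chart

/-! ## AVOID-L1 -/

/-- **AVOID-L1 — an equimultiple hypersurface misses the bad point.** Let `R` be a regular local ring with maximal ideal `𝔪`,
`e ∈ 𝔪 ∖ 𝔪²` a regular parameter, `w ∈ 𝔪²` with `w ∉ (e)` (so `Z = V(e, w)` is a local complete intersection curve germ, singular at
the closed point: a Δ-centre trace `w = g` or a comb node `w = xy`), and `H = V(y)` with `y ∈ (e, w)^ν` and `y ∉ 𝔪^{ν+1}` (multiplicity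
exactly `ν` both along `Z` and at the closed point: EQUIMULTIPLE). Then in the `e`-chart `B = R[Z/e]` of the blow-up of `Z` the
strict transform `y/e^ν` does NOT lie in the bad point `𝔓₀ = 𝔪B + (w/e)B` (the conifold vertex over the closed point): `St(H)`
avoids it. Proof: `y = c e^ν + w r`, `r ∈ (e,w)^{ν-1}`, and `w r ∈ 𝔪^{ν+1}` forces `c ∉ 𝔪`; `y/e^ν = c + (w/e)(r/e^{ν-1}) ≡ c`, a unit,
modulo `𝔓₀ ≠ ⊤`. [folklore; CRUX-PLAN v1.1 §3.4 L1 (res-L1-w45b-plan-1), Kollár 2007 §3.9 context] -/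
theorem divPow_notMem_badPoint {R : Type u} [CommRing R] [IsRegularLocalRing R] {e w y : R} {ν : ℕ}
    (he : e ∈ maximalIdeal R) (he₂ : e ∉ maximalIdeal R ^ 2) (hw : w ∈ maximalIdeal R ^ 2)
    (hwe : w ∉ Ideal.span {e}) (hy : y ∈ Ideal.span {e, w} ^ ν) (hy' : y ∉ maximalIdeal R ^ (ν + 1)) :
    blowupAlgebra.divPow (Ideal.span {e, w}) e hy ∉
      (maximalIdeal R).map (algebraMap R (blowupAlgebra (Ideal.span {e, w}) e)) ⊔
        Ideal.span {blowupAlgebra.gen (Ideal.span {e, w}) e w (mem_span_pair_right e w)} := by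
  haveI := isDomain_of_isRegularLocalRing R
  set B := blowupAlgebra (Ideal.span {e, w}) e
  set t := blowupAlgebra.gen (Ideal.span {e, w}) e w (mem_span_pair_right e w)
  set J := (maximalIdeal R).map (algebraMap R B) ⊔ Ideal.span {t}
  have hprime : Prime e := IsRegularLocalRing.prime_of_not_mem_sq he he₂
  have hw₁ : w ∈ maximalIdeal R := Ideal.pow_le_self two_ne_zero hw
  have hJ : J ≠ ⊤ := badPoint_ne_top hprime hw₁ hwe
  have hI : Ideal.span {e, w} ≤ maximalIdeal R := by
    rw [Ideal.span_le]
    rintro x (rfl | rfl)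
    · exact he
    · exact hw₁
  -- `y = c e^ν + w r`, `r ∈ (e,w)^{ν-1}`; the unit `c`
  obtain ⟨c, r, hr, hycr⟩ := exists_eq_mul_pow_add_mul_of_mem_span_pair_pow e w ν hy
  have hwr : w * r ∈ maximalIdeal R ^ (ν + 1) := by
    have h : w * r ∈ maximalIdeal R ^ (2 + (ν - 1)) := by
      rw [pow_add]; exact Ideal.mul_mem_mul hw (Ideal.pow_right_mono hI _ hr)
    exact Ideal.pow_le_pow_right (by omega) h
  have hc : IsUnit c := by
    by_contra h
    apply hy'
    rw [hycr]
    refine Ideal.add_mem _ ?_ hwr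
    rw [pow_succ']
    exact Ideal.mul_mem_mul ((mem_maximalIdeal _).mpr h) (Ideal.pow_mem_pow he ν)
  -- a unit of `R` inside `J` is absurd
  have key : algebraMap R B c ∉ J := fun h => hJ (J.eq_top_of_isUnit_mem h (hc.map _))
  have hwt : algebraMap R B w = algebraMap R B e * t := (blowupAlgebra.algebraMap_mul_gen _ e w _).symm
  intro hb
  apply key
  rcases ν with _ | μ
  · -- `ν = 0`: `y/e⁰ = y = c + w r = c + t · (e r)`
    have hb0 : blowupAlgebra.divPow (Ideal.span {e, w}) e hy = algebraMap R B y :=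
      Subtype.ext (by simp [B, Subalgebra.coe_algebraMap])
    have h1 : algebraMap R B c = algebraMap R B y - t * algebraMap R B (e * r) := by
      rw [hycr, pow_zero, mul_one, map_add, map_mul, hwt, map_mul]; ring
    rw [h1]
    exact J.sub_mem (hb0 ▸ hb) (Ideal.mem_sup_right (Ideal.mul_mem_right _ _ (Ideal.mem_span_singleton_self t)))
  · -- `ν = μ + 1`: `y/e^ν = c + t · (r/e^μ)`
    rw [Nat.add_sub_cancel] at hr
    have h1 : blowupAlgebra.divPow (Ideal.span {e, w}) e hy =
        algebraMap R B c + t * blowupAlgebra.divPow (Ideal.span {e, w}) e hr := by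
      apply Subtype.ext
      have hei : algebraMap R (Localization.Away e) e * Away.invSelf e = 1 := Away.mul_invSelf e
      have hpow : algebraMap R (Localization.Away e) e ^ (μ + 1) * Away.invSelf e ^ (μ + 1) = 1 := by
        rw [← mul_pow, hei, one_pow]
      simp only [blowupAlgebra.coe_divPow, Subalgebra.coe_add, Subalgebra.coe_mul, Subalgebra.coe_algebraMap,
        blowupAlgebra.coe_gen, B, t, hycr, map_add, map_mul, map_pow]
      linear_combination (algebraMap R (Localization.Away e) c) * hpow
    have h2 : algebraMap R B c = blowupAlgebra.divPow (Ideal.span {e, w}) e hy -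
        t * blowupAlgebra.divPow (Ideal.span {e, w}) e hr := by rw [h1]; ring
    rw [h2]
    exact J.sub_mem hb (Ideal.mem_sup_right (Ideal.mul_mem_right _ _ (Ideal.mem_span_singleton_self t)))

/-- **AVOID-L1, point form**: under the same hypotheses, `y/e^ν` lies in NO proper ideal of the chart containing `𝔪` and `w/e` —
in particular not in the maximal ideal of any point of the chart over the closed point of `R` at which `w/e` vanishes (there is
exactly one, `badPoint_isMaximal`). [folklore] -/
theorem divPow_notMem_of_le {R : Type u} [CommRing R] [IsRegularLocalRing R] {e w y : R} {ν : ℕ}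
    (he : e ∈ maximalIdeal R) (he₂ : e ∉ maximalIdeal R ^ 2) (hw : w ∈ maximalIdeal R ^ 2)
    (hwe : w ∉ Ideal.span {e}) (hy : y ∈ Ideal.span {e, w} ^ ν) (hy' : y ∉ maximalIdeal R ^ (ν + 1))
    (Q : Ideal (blowupAlgebra (Ideal.span {e, w}) e)) (hQ : Q ≠ ⊤)
    (hmQ : (maximalIdeal R).map (algebraMap R (blowupAlgebra (Ideal.span {e, w}) e)) ≤ Q)
    (htQ : blowupAlgebra.gen (Ideal.span {e, w}) e w (mem_span_pair_right e w) ∈ Q) :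
    blowupAlgebra.divPow (Ideal.span {e, w}) e hy ∉ Q := by
  haveI := isDomain_of_isRegularLocalRing R
  have hprime : Prime e := IsRegularLocalRing.prime_of_not_mem_sq he he₂
  have hw₁ : w ∈ maximalIdeal R := Ideal.pow_le_self two_ne_zero hw
  have hmax := badPoint_isMaximal hprime hw₁ hwe
  have hle : (maximalIdeal R).map (algebraMap R (blowupAlgebra (Ideal.span {e, w}) e)) ⊔
      Ideal.span {blowupAlgebra.gen (Ideal.span {e, w}) e w (mem_span_pair_right e w)} ≤ Q :=
    sup_le hmQ (by rw [Ideal.span_le, Set.singleton_subset_iff]; exact htQ)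
  rw [← hmax.eq_of_le hQ hle]
  exact divPow_notMem_badPoint he he₂ hw hwe hy hy'

end Summit.ResolutionOfSingularities.ResolutionOfSingularities.Cruxes.EquisingularLiftNat.Sections

end
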